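import Summits.QuantumFields.YangMills.Theorems.BalabanUVNodesN12AtRecord13Prop1KnitThm1OfRecord
import Summits.QuantumFields.YangMills.Theorems.BalabanUVNodesN12Prop1AssembledOfGaugeLetterLocAtRecordOfChartLetterN

/-!
# BalabanUVNodes ∕ N12 — «12Q¹⁵»: N12's Proposition-1 row at the record FROM THE ASSEMBLED, LOCALISED ENDPOINT WITH THE GAUGE LETTER DISCHARGED BY NAME, FOREST-FREE ∕ hT-FREE (dag-n12-w3's capstone inside)

Cell `pub-ymgap` (HUMAN RULINGS D-0062 ∕ D-0149), seat `pub-ymgap-dag-n12-d` g19 (R134 N12 [B15] s2; edition 2 of the session = by-name knit at the record); count-neutral helper of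
K1⁹ `stmt-QuantumFields-27364` (`--kind proof --supports … --as helper`).  THEOREMS ONLY (0 `def`, 0 `instance`, 0 `sorry`); composition BY NAME.

WHAT.  The witness-grade edition of N12's Prop-1 row with the GAUGE LETTER DISCHARGED (lane owner dag-n12-c g19, cell bus 2026-08-28T13:00Z «the witness-grade knit is 12Q¹² on w5's (iii)∕(iv)»):
12Q¹⁰ (p633594) ∕ ¹¹ (p636316) ∕ ¹² (p638625) ∕ ¹³ (p641033) ∕ ¹⁴ (p643795) re-keyed on dag-n12-w5 g5's (vii) `…N12Prop1AssembledOfGaugeLetterLocAtRecordOfChartLetterN` (= (v) with `hσN` DISCHARGED through dag-n12-w3 g4's forest-free ∕ hT-free capstone `N12GaugeLetterLocAtRecord` (p645693; forest package `exists_towerForest_rooted_Bj`, budgets and the root-transporter letter `rootTransporter_atRecord_graded_of_plaqSmall` are INSIDE it) via `N12GaugeLetterSocketAtRecord.hσN_of_gaugeLetterLocAtRecord_linear`: displayed instead, per instance, the no-wrap numerics `hNcap`, the `N`-geometry, a reference guard with moduli `e₀ cP cθ cδ`, the minimiser's plaquette letter `hP` with LEVEL-FORM boxes `hSΩ`, the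 iterated-average plaquette letter `ha` with budgets `a θ` (`hθ0 ha0 haN hθ hθk`) and the datum letter `hWj`; 12Q¹⁴ was keyed on (vi) `…N12Prop1AssembledOfForestPackageLocOfChartLetterN` = (v) with the ∀δ∃e gauge letter `hσN` DISCHARGED BY NAME from dag-n12-w6 g2's forest-package producer `B15Prop1GaugeLetterLocOfForestPackage.exists_gaugeLetterLoc_atRecord_of_forestPackage` through dag-n12-w5's `B15Prop1GaugeLetterSocketOfForestPackage.hσN_of_forestPackage_linear`: displayed instead, per instance, the rooted tower-forest package, budgets, the `N`-geometry, a reference guard with moduli, the graded root-free PLAQUETTE letter at the minimiser and the ROOT-TRANSPORTER letter, both LINEAR IN THE GUARD; (v) = (iv) with dag-n12-w4's localised chart letter `chartLetter_of_letters_N` supplied INSIDE: the chart constants `ρs Cμ Cρ C₂ Cτ` and the chart body (χ)_N are no longer displayed — instead dag-n12-w4's geometry letter `hΩw` and the locality letter `hNpos : inputsPos 𝐁_k(Z) ⊆ N`) — the endpoint that (a) LOCALISES the `inputs`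
near-flatness of the gauge letter and of the chart letter to a bond neighbourhood `N i` (LOCATED-CIN: producers have it only there), (b) takes the gauge letter (σ)_N in the
∀δ∃e form of dag-n12-w6's `B15Prop1GaugeLetterGammaZeroPin` §5, and (c) EXECUTES dag-n12-c's assembly order (1)–(5) inside for a FINITE instance family: chart constants ⊢
Schur size `K := n+1` ⊢ threshold `δ₀` (`B15Prop1NumericsThresholds`) ⊢ guard below the reference guard, the gauge letter's guard and the [15] door's caps ⊢ datum tolerance
linear in the guard ⊢ `γ := (12d)²∕(10·bx²)`, `cE cA cJ` by `Finite.exists_le`.  Per run `P` this file feeds it the run's lattice `F.P P.K` and composes with 12E.  Net per-run ∕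
per-instance Prop-1 display of N12 below the torus: (J0′) R-explicit at a reference guard, dag-n12-w4's geometry letter `hΩw` + locality letter `hNpos`, `N` + (gN1)(gN2),
no-wrap numerics, the three letters (minimiser plaquettes in level form, iterated-average plaquettes with budgets, datum), geometry, `h15`, sign letters `0 < bx`, `0 < a₁'`, `0 < εreg`, and `[Finite (ι P)]`.

HONEST FRAMING ∕ LOCATED.  Bookkeeping by name over landed modules; (J0′), the three plaquette ∕ datum letters, [15] Thm 1, the geometry, K0b's residuals and N12's per-run rows below the torus
(live-mass, (1.100) pin, (1.80), (1.89)) stay LETTERS; a currency edition (`Cρ` carries dag-n10-w1's LOCATED-RHO floor); nothing of Bałaban's asserted; N12 NOT discharged;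
K0⁷ ∕ K1⁹ NOT closed; counts unmoved; one finite 𝕋⁴ programme at fixed `ε = L^{-K}` — R4 closes only the conditional rung `BalabanLadder.UV`; no summit statement is proved
here and NOT the Yang–Mills mass gap (Clay); nothing continuum ∕ ℝ⁴ ∕ OS.

References: [Balaban1989LargeFieldI] CMP 122 (1989) 175–202; [Balaban1989LargeFieldII] CMP 122 (1989) 355–392; [Balaban1988Convergent] CMP 119 (1988) 243–285;
[Balaban1985Variational] CMP 102 (1985) 277–309 (locators in the theorem docstring).
-/

noncomputable section
open MeasureTheory Set Finset Metric Filter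
open scoped Matrix.Norms.L2Operator BigOperators Matrix RealInnerProductSpace Real InnerProductSpace Topology

namespace Summit.QuantumFields.YangMills.BalabanUVNodes.N12AtRecord13Prop1KnitThm1AssembledGaugeLocAtRecordChartLetterNOfRecord

open Literature.MathematicalPhysics.QuantumFieldTheory.Balaban1983to89
open Literature.MathematicalPhysics.QuantumFieldTheory.Balaban1983to89.T4Continuum (T4Family LStep Letter walk walkEnd netDisp holAt)
open Literature.MathematicalPhysics.QuantumFieldTheory.Balaban1983to89.DagBinding
open Literature.MathematicalPhysics.QuantumFieldTheory.Balaban1983to89.Node00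
open FlowStep (prefixOf BetaLowerH BetaUpperH)
open B15Claim189Assembly (Setting189 new189 chiPP dom half)
open B15 (Prop1Printed Ineq180)
open B15.BasicStep (Claim189)
open B15.PrelimIntegrations (Ineq191 Ineq195)
open B15Chi124DetSets (E124)
open B14DomainGeom (Pt)
open B8Eq17ClassAkV1 (plaqsOf)
open B14.Eq216Concrete (inputs)
open GaugeGroup (dist1)
open GaugeField (plaqHol gaugeAct)
open B15Claim189PrintedConditions (omegaOfChain)
open B15Claim189PinsOfHistory (N0OfRecord₁₃)
open B15Claim189LambdaPin (enlD)
open B15RPrime1100OfRep (rPrimeDataOfSel)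
open Summit.QuantumFields.YangMills.BalabanUVNodes.N12AtRecord13OfResiduals (b15Leaf_WOfRecord₁₃_liveRepin₁₃_of_massLive_of_hasResiduals)
open Summit.QuantumFields.YangMills.BalabanUVNodes.N12AtRecord13Prop1KnitThm1OfRecord (thm1TorusClass_of_variationalThm1RegSepCoP7M)
open T4CubeChartGnomonic (SU2)
open B15Prop1ChartSU2 (su2Chart)
open B15Prop1SliceCoordinates (GaugeSlice ιA)
open T4AxialGaugeSmallField (castSite boxPlaqs boxBonds)
open B6BondElimination (unitVec)
open B6TreeGaugePoincare (curl)
open B16Eq18Proof (box)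
open B15Extension193 (extend)
open B15ShellGauge193 (shellGauge)
open B15Sect1Instances (fun177std)
open B14.Eq213DetSet (Bj maxDomT)
open B14.Eq213MaximalDomains (side)
open B14.Eq22Determines (blockIter IsBlockUnion)
open Literature.MathematicalPhysics.QuantumFieldTheory.BalabanImbrieJaffe1984to88.BIJ85Eq453GaugeField (qsstarGIter0)
open B16Sect1Backgrounds (expMul toMS)
open B15DeterminingSets (pts DetBackground genSet IsMinimizer MSField avgFamily bondsOf DetSet embIter)
open B5Eq118OneStroke (iterBlockOf)
open ExpMeanLog (deltaSU)
open B15Prop1Carrier (lfVarOn InstOn InstOn.std plaqsInside)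
open Summit.QuantumFields.YangMills.BalabanUVNodes.N12Prop1AssembledOfGaugeLetterLocAtRecordOfChartLetterN (exists_domain_prop1Printed_lfVarOn_std_su2_box_intrinsic_analytic_atZSeqCoPRecord_ofThm1TorusClass_ofMinimiserFamily_ofGaugeLetterLocAtRecordAtTolerance_ofChartLetterN_ofCoercive)
open T4AdjointCovarianceUnitary (lieSU)
open B15Prop1GradientFromNearValueAtCoPRecord (far_letter_of_box)
open B15Prop1AnalyticExtClause (cplxVec anExt)
open B15Prop1ChartCalculusSU2 (E3)

variable {F : T4Family}

/-! ## §1 `N = 2`, generic `Θ` carrying node00-def-K0b's residuals: 12Q¹⁴ re-keyed on the FULLY ASSEMBLED LOCALISED endpoint with the gauge letter discharged by name, forest-free ∕ hT-free -/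

section Generic
variable (Θ : Stage13Params F 2) (lam : ResidW F 2)

/-- **★★★★ N12's ROW BELOW THE TORUS AT THE LIVE RE-PIN, `N = 2`, AT PRINT's (1.74) OBJECT, PROP. 1 FROM THE FULLY ASSEMBLED LOCALISED ENDPOINT, GAUGE LETTER DISCHARGED BY NAME, FOREST-FREE ∕ hT-FREE** — 12Q¹⁴ (p643795)
re-keyed on dag-n12-w5's (vii) `…N12Prop1AssembledOfGaugeLetterLocAtRecordOfChartLetterN.…_ofMinimiserFamily_ofGaugeLetterLocAtRecordAtTolerance_ofChartLetterN_ofCoercive` (dag-n12-w4's `chartLetter_of_letters_N` AND dag-n12-w3's capstone `exists_gaugeLetterLoc_atRecord` via dag-n12-w5's `hσN_of_gaugeLetterLocAtRecord_linear` INSIDE) (lane ruling LOCATED-CIN (R-a) + dag-n12-c's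
assembly order (1)–(5) EXECUTED INSIDE the endpoint): per run `P` and FINITE instance family `ι P` the Prop-1 side displays ONLY (J0′) R-explicit at a REFERENCE guard `eR₀ P i`,
dag-n12-w4's geometry letter `hΩw` and locality letter `hNpos : inputsPos 𝐁_k(Z) ⊆ N P i`, the bond neighbourhood `N P i` with its geometry (gN1)(gN2), the no-wrap numerics
`hNcap` at the caps `ℓ_k`, `m·L^k`, a reference guard `e₀` with moduli `cP cθ cδ`, the graded root-free PLAQUETTE letter at the minimiser `hP` on `S` with LEVEL-FORM boxes `hSΩ`, the
ITERATED-AVERAGE plaquette letter `ha` near the member segments with budgets `a θ` (`hθ0 ha0 haN hθ hθk`) and the DATUM letter `hWj` — linear ∕ guard-indexed —, the geometry (`hZ1 hZblk hdiv`, boxes) and the [15] letter `h15`; the gauge letter (σ)_N, the chart constants and the chart body (χ)_N, the Schur size, the positivity constant (`γ := (12d)²∕(10·bx²)`, read by the LF radius), the smallness threshold, the guard,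
the datum tolerance and the bookkeeping constants `cE cA cJ` are chosen INSIDE (`B15Prop1NumericsThresholds`, `Finite.exists_le`).  The conclusion PRODUCES the thresholds
`areg P i`; then 12E's `b15Leaf_WOfRecord₁₃_liveRepin₁₃_of_massLive_of_hasResiduals`.  WHAT STAYS A LETTER: everything displayed; K0b's residuals `hres`; N12's per-run
displays below the torus ((1.100) pin, live-mass, (1.80), (1.89)).  Count-neutral; NOT a discharge of N12. [cite: Balaban1989LargeFieldI, (0.2)–(0.6) p.176, (1.74) p.192, p.193 ll.14–20, Prop. 1 (1.77)–(1.78) p.194 («for ε > 0 sufficiently small»), (1.79)–(1.80) p.195, (1.89) p.198, (1.99)–(1.102) pp.200–201; Balaban1989LargeFieldII, p.357, (1.7)–(1.13) pp.358–359, (1.17)–(1.19) pp.360–361; Balaban1988Convergent, (2.1) p.254, (2.12)–(2.14) pp.256–257, (2.18) p.257, (3.16) p.268, (3.22)–(3.25) pp.269–270; Balaban1985Variational, (3)–(4) p.278, Thm 1 (8) p.279, (16)–(18) p.280, Prop. 9 (190) p.309 (bookkeeping)] -/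
theorem exists_areg_pinLF_b15Leaf_WOfRecord₁₃_liveRepin₁₃_of_massLive_of_hasResiduals_of_variationalThm1RegSepCoP7M_atZSeqCoPRecord_assembledGaugeLocAtRecordChartLetterN (hres : Θ.HasResidualsOfRecord F 2)
    -- N12's displays at the letters `kSel ∕ D189 ∕ D1100` of `λ`, run by run, BELOW THE TORUS
    (hpin : ∀ P : B12.RunParams, lam.kSel P < P.K → lam.D1100 P
      = rPrimeDataOfSel (reprTOfRecord₁₃ F 2 (Θ.liveRepin₁₃ F 2) P (lam.kSel P))
          ((Θ.liveRepin₁₃ F 2).ppSel P (gOfRecord₁₃ F 2 (Θ.liveRepin₁₃ F 2) P) (lam.kSel P + 1))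
          (fibOfSeq F (Θ.liveRepin₁₃ F 2).ν (Θ.liveRepin₁₃ F 2).τ9 P (gOfRecord₁₃ F 2 (Θ.liveRepin₁₃ F 2) P) (lam.kSel P + 1)))
    (hmassLive : ∀ P : B12.RunParams, lam.kSel P < P.K → ∀ s, LiveSeq F 2 Θ.ν Θ.τ9 P (gOfRecord₁₃ F 2 (Θ.liveRepin₁₃ F 2) P) (lam.kSel P + 1)
        (slotsTOfRecord F 2 Θ.ν Θ.τ9 (EOfRecord₁₃ F 2 (Θ.liveRepin₁₃ F 2)) (wOfRecord₉ F 2 (Θ.liveRepin₁₃ F 2).toStage9Params)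
          (Θ.liveRepin₁₃ F 2).ppSel P (gOfRecord₁₃ F 2 (Θ.liveRepin₁₃ F 2) P) (lam.kSel P + 1)) s →
      0 < ∫ V, rterm (reprTOfRecord₁₃ F 2 (Θ.liveRepin₁₃ F 2) P (lam.kSel P)) s V ∂(fieldMeasure (F.P P.K) (lam.kSel P + 1) (SU 2)))
    (h180 : ∀ P : B12.RunParams, lam.kSel P < P.K → ∀ U, new189 (lam.D189 P) U → ∀ i, (lam.D189 P).h ≤ i → i ≤ (lam.D189 P).k →
      ∀ q ∈ plaqsOf (dom (lam.D189 P) i),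
        Ineq180 ((lam.D189 P).dev0 U q) ((lam.D189 P).ε (lam.D189 P).k) (lam.D189 P).η (lam.D189 P).B₃ (lam.D189 P).B₅ (lam.D189 P).M (lam.D189 P).δ
          ((lam.D189 P).dist q) (lam.D189 P).O1)
    (h189 : ∀ P : B12.RunParams, lam.kSel P < P.K → Claim189 (new189 (lam.D189 P)) (chiPP (lam.D189 P)))
    -- dag-n12-w5's ASSEMBLED LOCALISED endpoint's letters ON THE RUN's LATTICE, per run `P` and FINITE instance family `ι P`: structure ∕ region boxes ∕ (J0′) at a
    -- REFERENCE guard ∕ no-wrap + `N`-geometry + the three letters (minimiser plaquettes, iterated-average plaquettes with budgets `a θ`, datum) ((σ)_N by name inside, forest-free) ∕ `hΩw` ((χ)_N inside) ∕ geometry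
    (hd3 : ∀ P : B12.RunParams, 3 ≤ (F.P P.K).d) (h0 : ∀ P : B12.RunParams, 0 < (F.P P.K).d) (ι : B12.RunParams → Type) [hfin : ∀ P : B12.RunParams, Finite (ι P)]
    {B₃ a₀ a₁' : ℝ}
    (Z Λ : ∀ P : B12.RunParams, ι P → Set (Site (F.P P.K) 0)) (k : ∀ P : B12.RunParams, ι P → ℕ) (M : ∀ P : B12.RunParams, ι P → ℝ) (hk0 : ∀ P i, 0 < k P i) (hk : ∀ P i, k P i ≤ (F.P P.K).m + (F.P P.K).K)
    -- the REFERENCE guard per instance (the guard of the row is chosen below it, inside the endpoint)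
    (eR₀ : ∀ P : B12.RunParams, ι P → ℝ) (heR₀ : ∀ P i, 0 < eR₀ P i)
    (T : ∀ (P : B12.RunParams) (i : ι P), Finset (PBond (F.P P.K) (k P i)))
    (lo hi : ∀ P : B12.RunParams, ι P → Fin (F.P P.K).d → ℤ) (n : ∀ P : B12.RunParams, ι P → ℕ) (hn : ∀ P i κ, hi P i κ ≤ lo P i κ + n P i) (hN : ∀ P i, n P i + 2 < (F.P P.K).sitesPerDir (k P i))
    (hbox : ∀ P i, pts (k P i) (Λ P i) = (castSite '' Set.Icc (lo P i) (hi P i) : Set (Site (F.P P.K) (k P i))))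
    (hZ : ∀ P i, (boxPlaqs (lo P i - 1) (hi P i + 1) : Set (Plaq (F.P P.K) (k P i))) ⊆ plaqsInside (pts (k P i) (Z P i)))
    (hTG0 : ∀ P i, T P i = (box (fun κ => (hi P i κ - lo P i κ + 1).toNat) (lo P i)).image fun x =>
      (⟨castSite (x - unitVec ⟨0, h0 P⟩), ⟨0, h0 P⟩⟩ : PBond (F.P P.K) (k P i)))
    (hN5 : ∀ P i κ, ((hi P i κ - lo P i κ + 1).toNat : ℤ) + 5 < (F.P P.K).sitesPerDir (k P i))
    (ext : ∀ (P : B12.RunParams) (i : ι P), GaugeField (F.P P.K) (k P i) SU2 → GaugeField (F.P P.K) (k P i) SU2)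
    (hext : ∀ P i Vk, ext P i Vk = extend (pts (k P i) (Λ P i)) (shellGauge Vk (lo P i) (hi P i)) Vk)
    (hlohi : ∀ P i, lo P i ≤ hi P i)
    -- the REGION parallelepipeds of the normalisation (the datum tolerances are chosen inside, linear in the guard)
    (LO HI : ∀ P : B12.RunParams, ι P → Fin (F.P P.K).d → ℤ) (hLO : ∀ P i, LO P i ≤ lo P i - 1) (hHI : ∀ P i, hi P i + 1 ≤ HI P i) (n' : ∀ P : B12.RunParams, ι P → ℕ) (hn' : ∀ P i κ, HI P i κ ≤ LO P i κ + n' P i)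
    (hn'N : ∀ P i, n' P i < (F.P P.K).sitesPerDir (k P i)) (hR' : ∀ P i, (boxPlaqs (LO P i) (HI P i) : Set (Plaq (F.P P.K) (k P i))) ⊆ plaqsInside (pts (k P i) (Z P i)))
    {bx : B12.RunParams → ℝ} (hbx : ∀ P, 0 < bx P)
    (hbxM : ∀ P i, 12 * ((F.P P.K).d : ℝ) * ((n P i : ℝ) + 2) ^ 2 ≤ bx P * (M P i) ^ 2)
    {R 𝓐₀ : ∀ P : B12.RunParams, ι P → ℝ} (hM : ∀ P i, 1 ≤ (M P i)) (hR : ∀ P i, 0 < R P i)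
    -- (J0′), R-EXPLICIT, AT THE REFERENCE GUARD `eR₀`: per instance one radius and one bound for every base field of the strict guard
    (hMin : ∀ P i Vk, PlaqSmallOn (plaqsInside (pts (k P i) (Z P i ∩ (Λ P i)ᶜ))) (eR₀ P i) Vk →
      ∃ Ũ : VecField (F.P P.K) (k P i) (EuclideanSpace ℂ (Fin 3)) × VecField (F.P P.K) (k P i) (EuclideanSpace ℂ (Fin 3)) →
          PBond (F.P P.K) 0 → Matrix (Fin 2) (Fin 2) ℂ,
        (∀ b a c, DifferentiableOn ℂ (fun z => Ũ z b a c) (ball 0 (R P i))) ∧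
        (∀ z ∈ ball (0 : VecField (F.P P.K) (k P i) (EuclideanSpace ℂ (Fin 3)) × VecField (F.P P.K) (k P i) (EuclideanSpace ℂ (Fin 3))) (R P i),
          ∀ b a c, ‖Ũ z b a c‖ ≤ 𝓐₀ P i) ∧
        ∀ p B' : VecField (F.P P.K) (k P i) E3, ‖p‖ < R P i → ‖B'‖ < R P i → ∃ U' : GaugeField (F.P P.K) 0 SU2,
          (∀ b, Ũ (cplxVec p, cplxVec B') b = ((U' b : SU2) : Matrix (Fin 2) (Fin 2) ℂ)) ∧
            IsMinimizer (Node00.avOfRecord F 2 P.K) (Node00.regMSCoPOfRecord F 2 Θ.ν P.K (k P i) (maxDomT Θ.ν.M₁ (Z P i))) (Bj Θ.ν.M₁ (Z P i) (k P i))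
              (avgFamily (Node00.avOfRecord F 2 P.K) (qsstarGIter0 (k P i) (expMul su2Chart B' (ext P i (expMul su2Chart p Vk))))) U')
    (h𝓐₀ : ∀ P i, 0 ≤ 𝓐₀ P i)
    -- LOCATED-CIN (R-a): per instance the bond neighbourhood on which the `inputs` near-flatness is delivered ∕ asked, with dag-n12-w4's ONE locality letter on it
    (N : ∀ P : B12.RunParams, ι P → Set (PBond (F.P P.K) 0)) (hNpos : ∀ P i, B14.Eq12InteriorLocality.inputsPos (Bj Θ.ν.M₁ (Z P i) (k P i) : DetSet (F.P P.K)) ⊆ N P i)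
    -- (σ)_N DISCHARGED BY NAME ONE PRODUCER DEEPER (dag-n12-w5's (vii) over dag-n12-w3's forest-free ∕ hT-free capstone `N12GaugeLetterLocAtRecord.exists_gaugeLetterLoc_atRecord`
    -- through `N12GaugeLetterSocketAtRecord.hσN_of_gaugeLetterLocAtRecord_linear`): per run ∕ instance the no-wrap numerics at the caps, the `N`-geometry (gN1)(gN2), a reference guard
    -- with moduli, and the three DISPLAYED letters read linear ∕ guard-indexed: the graded root-free plaquette letter at the minimiser with LEVEL-FORM boxes ((1.7) ∕ [15] Thm 1),
    -- the plaquette letter on the iterated averages near the member segments with budgets `a`∕`θ`, and the datum letter at the members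
    -- no wrapping, at the caps `ℓ_k`, `m·L^k`
    (hNcap : ∀ (P : B12.RunParams) (i : ι P), 2 * (∑ l ∈ Finset.range (k P i + 1), ((F.P P.K).d * (((F.P P.K).L ^ l - 1) / 2) + 1)) + 1 +
      (3 * ((F.P P.K).d * (((F.P P.K).L - 1) / 2)) + 5) * (F.P P.K).L ^ (k P i) < (F.P P.K).sitesPerDir 0)
    -- geometry of the neighbourhood `N i` (dag-n12-w6's letters; (gN1) at the region box, (gN2))
    (hGN : ∀ (P : B12.RunParams) (i : ι P), ∀ b ∈ (N P i), (b.src ∉ maxDomT Θ.ν.M₁ (Z P i) 1 ∨ b.tgt ∉ maxDomT Θ.ν.M₁ (Z P i) 1) → B14.Eq22Determines.blockIter (k P i) b.tgt ≠ B14.Eq22Determines.blockIter (k P i) b.src →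
      (⟨B14.Eq22Determines.blockIter (k P i) b.src, b.dir⟩ : PBond (F.P P.K) (k P i)) ∈ (boxBonds (LO P i) (HI P i) : Set (PBond (F.P P.K) (k P i))))
    (hN1 : ∀ (P : B12.RunParams) (i : ι P), ∀ p : Plaq (F.P P.K) 0, ((⟨p.src, p.μ⟩ : PBond (F.P P.K) 0) ∈ {b : PBond (F.P P.K) 0 | b.src ∈ maxDomT Θ.ν.M₁ (Z P i) 1} ∨
        (⟨p.src.shift p.μ, p.ν⟩ : PBond (F.P P.K) 0) ∈ {b : PBond (F.P P.K) 0 | b.src ∈ maxDomT Θ.ν.M₁ (Z P i) 1} ∨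
        (⟨p.src.shift p.ν, p.μ⟩ : PBond (F.P P.K) 0) ∈ {b : PBond (F.P P.K) 0 | b.src ∈ maxDomT Θ.ν.M₁ (Z P i) 1} ∨
        (⟨p.src, p.ν⟩ : PBond (F.P P.K) 0) ∈ {b : PBond (F.P P.K) 0 | b.src ∈ maxDomT Θ.ν.M₁ (Z P i) 1}) →
      (⟨p.src, p.μ⟩ : PBond (F.P P.K) 0) ∈ (N P i) ∧ (⟨p.src.shift p.μ, p.ν⟩ : PBond (F.P P.K) 0) ∈ (N P i) ∧
        (⟨p.src.shift p.ν, p.μ⟩ : PBond (F.P P.K) 0) ∈ (N P i) ∧ (⟨p.src, p.ν⟩ : PBond (F.P P.K) 0) ∈ (N P i))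
    -- the reference guard and the LINEAR moduli of the three displayed letters
    (e₀ cP cθ cδ : ∀ P : B12.RunParams, ι P → ℝ) (he₀ : ∀ (P : B12.RunParams) (i : ι P), 0 < e₀ P i) (hcP : ∀ (P : B12.RunParams) (i : ι P), 0 ≤ cP P i) (hcδ : ∀ (P : B12.RunParams) (i : ι P), 0 ≤ cδ P i)
    -- DISPLAYED, LINEAR IN THE GUARD: ONE graded root-free plaquette letter for the minimiser ((1.7) ∕ [15] Thm 1), boxes in LEVEL FORM inside `S`
    (S : ∀ P : B12.RunParams, ι P → Set (Plaq (F.P P.K) 0))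
    (hP : ∀ (P : B12.RunParams) (i : ι P), ∀ e : ℝ, 0 < e → e ≤ (e₀ P i) → ∀ (Vk : GaugeField (F.P P.K) (k P i) SU2), PlaqSmallOn (plaqsInside (pts (k P i) ((Z P i) ∩ (Λ P i)ᶜ))) e Vk →
      (∀ b ∈ (boxBonds (LO P i) (HI P i) : Set (PBond (F.P P.K) (k P i))), dist1 ((ext P i) Vk b) ≤
        (((F.P P.K).d : ℝ) * (n' P i) + 1) * ((((F.P P.K).d - 1 : ℕ) : ℝ) * (n' P i) * ((12 * (F.P P.K).d * ((n P i) + 2) ^ 2 + 1) * e) + 3 * (F.P P.K).d * ((n P i) + 2) ^ 2 * e)) →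
      ∀ U₀ : GaugeField (F.P P.K) 0 SU2,
        IsMinimizer (Node00.avOfRecord F 2 P.K) (Node00.regMSCoPOfRecord F 2 Θ.ν P.K (k P i) (maxDomT Θ.ν.M₁ (Z P i))) (Bj Θ.ν.M₁ (Z P i) (k P i))
          (avgFamily (Node00.avOfRecord F 2 P.K) (qsstarGIter0 (k P i) ((ext P i) Vk))) U₀ →
        PlaqSmallOn (S P i) ((cP P i) * e) U₀)
    (hSΩ : ∀ (P : B12.RunParams) (i : ι P), ∀ b : PBond (F.P P.K) 0, b.src ∈ maxDomT Θ.ν.M₁ (Z P i) 1 → b.tgt ∈ maxDomT Θ.ν.M₁ (Z P i) 1 →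
      ∀ J J' : ℕ, iterBlockOf J b.src ∈ (Bj Θ.ν.M₁ (Z P i) (k P i) : DetSet (F.P P.K)) J → iterBlockOf J' b.tgt ∈ (Bj Θ.ν.M₁ (Z P i) (k P i) : DetSet (F.P P.K)) J' →
      (boxPlaqs
          (fun κ => ((b.src κ).val : ℤ) -
            (((2 * max (∑ i ∈ Finset.range (J + 1), ((F.P P.K).d * (((F.P P.K).L ^ i - 1) / 2) + 1))
                  (∑ i ∈ Finset.range (J' + 1), ((F.P P.K).d * (((F.P P.K).L ^ i - 1) / 2) + 1)) + 1 +
                (3 * ((F.P P.K).d * (((F.P P.K).L - 1) / 2)) + 5) * (F.P P.K).L ^ min (J + 1) (k P i)) +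
              ∑ i ∈ Finset.range (J + 1), ((F.P P.K).d * (((F.P P.K).L ^ i - 1) / 2) + 1) : ℕ) : ℤ))
          (fun κ => ((b.src κ).val : ℤ) +
            (((2 * max (∑ i ∈ Finset.range (J + 1), ((F.P P.K).d * (((F.P P.K).L ^ i - 1) / 2) + 1))
                  (∑ i ∈ Finset.range (J' + 1), ((F.P P.K).d * (((F.P P.K).L ^ i - 1) / 2) + 1)) + 1 +
                (3 * ((F.P P.K).d * (((F.P P.K).L - 1) / 2)) + 5) * (F.P P.K).L ^ min (J + 1) (k P i)) +
              ∑ i ∈ Finset.range (J + 1), ((F.P P.K).d * (((F.P P.K).L ^ i - 1) / 2) + 1) : ℕ) : ℤ) + 2) : Set (Plaq (F.P P.K) 0)) ⊆ (S P i))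
    -- DISPLAYED, GUARD-INDEXED: the plaquette letter on the iterated averages of the minimiser near the member segments, with its budgets `a e`, `θ e` (per guard `e`) and a LINEAR cap on `θ e k`
    (a θ : ∀ P : B12.RunParams, ι P → ℝ → ℕ → ℝ) (hθ0 : ∀ (P : B12.RunParams) (i : ι P) e, 0 ≤ θ P i e 0) (ha0 : ∀ (P : B12.RunParams) (i : ι P) e l, 0 ≤ a P i e l)
    (haN : ∀ (P : B12.RunParams) (i : ι P), ∀ e : ℝ, 0 < e → e ≤ e₀ P i → ∀ l < k P i, (((((F.P P.K).d + 2) * (F.P P.K).L : ℕ) : ℝ) ^ 2 / 4) * a P i e l < deltaSU (Fin 2))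
    (hθ : ∀ (P : B12.RunParams) (i : ι P) e l, 6 * ((((((F.P P.K).d + 2) * (F.P P.K).L : ℕ) : ℝ) ^ 2 / 4) * a P i e l) + (F.P P.K).L * θ P i e l ≤ θ P i e (l + 1))
    (hθk : ∀ (P : B12.RunParams) (i : ι P), ∀ e : ℝ, 0 < e → e ≤ e₀ P i → θ P i e (k P i) ≤ cθ P i * e)
    (ha : ∀ (P : B12.RunParams) (i : ι P), ∀ e : ℝ, 0 < e → e ≤ (e₀ P i) → ∀ (Vk : GaugeField (F.P P.K) (k P i) SU2), PlaqSmallOn (plaqsInside (pts (k P i) ((Z P i) ∩ (Λ P i)ᶜ))) e Vk →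
      (∀ b ∈ (boxBonds (LO P i) (HI P i) : Set (PBond (F.P P.K) (k P i))), dist1 ((ext P i) Vk b) ≤
        (((F.P P.K).d : ℝ) * (n' P i) + 1) * ((((F.P P.K).d - 1 : ℕ) : ℝ) * (n' P i) * ((12 * (F.P P.K).d * ((n P i) + 2) ^ 2 + 1) * e) + 3 * (F.P P.K).d * ((n P i) + 2) ^ 2 * e)) →
      ∀ U₀ : GaugeField (F.P P.K) 0 SU2,
        IsMinimizer (Node00.avOfRecord F 2 P.K) (Node00.regMSCoPOfRecord F 2 Θ.ν P.K (k P i) (maxDomT Θ.ν.M₁ (Z P i))) (Bj Θ.ν.M₁ (Z P i) (k P i))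
          (avgFamily (Node00.avOfRecord F 2 P.K) (qsstarGIter0 (k P i) ((ext P i) Vk))) U₀ →
      ∀ lv ≤ (k P i), ∀ c ∈ bondsOf ((Bj Θ.ν.M₁ (Z P i) (k P i) : DetSet (F.P P.K)) lv), ∀ l < lv, ∀ c' : PBond (F.P P.K) (l + 1), c'.dir = c.dir →
      (∃ s < (F.P P.K).L ^ lv, embIter (l + 1) c'.src = (fun z : Site (F.P P.K) 0 => z.shift c.dir)^[s] (embIter lv c.src)) →
      ∀ q : Plaq (F.P P.K) l, (blockOf q.src = c'.src.unshift c'.dir ∨ blockOf q.src = c'.src ∨ blockOf q.src = c'.tgt) →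
        dist1 (GaugeField.plaqHol (avgFamily (Node00.avOfRecord F 2 P.K) U₀ l) q) < a P i e l)
    -- DISPLAYED, LINEAR IN THE GUARD: the datum letter at the members (levels `≤ k`) for every guarded base field
    (hWj : ∀ (P : B12.RunParams) (i : ι P), ∀ e : ℝ, 0 < e → e ≤ (e₀ P i) → ∀ (Vk : GaugeField (F.P P.K) (k P i) SU2), PlaqSmallOn (plaqsInside (pts (k P i) ((Z P i) ∩ (Λ P i)ᶜ))) e Vk →
      (∀ b ∈ (boxBonds (LO P i) (HI P i) : Set (PBond (F.P P.K) (k P i))), dist1 ((ext P i) Vk b) ≤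
        (((F.P P.K).d : ℝ) * (n' P i) + 1) * ((((F.P P.K).d - 1 : ℕ) : ℝ) * (n' P i) * ((12 * (F.P P.K).d * ((n P i) + 2) ^ 2 + 1) * e) + 3 * (F.P P.K).d * ((n P i) + 2) ^ 2 * e)) →
      ∀ lv ≤ (k P i), ∀ c ∈ bondsOf ((Bj Θ.ν.M₁ (Z P i) (k P i) : DetSet (F.P P.K)) lv), dist1 (avgFamily (Node00.avOfRecord F 2 P.K) (qsstarGIter0 (k P i) ((ext P i) Vk)) lv c) ≤ (cδ P i) * e)
    -- dag-n12-w4's GEOMETRY letter of the chart file (its chart constants and the localised chart body (χ)_N are supplied INSIDE the endpoint, from `chartLetter_of_letters_N`)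
    (hΩw : ∀ P i, ∀ (ν' : Fin (F.P P.K).d), ∀ z ∈ box (fun κ => (hi P i κ - lo P i κ + 1).toNat + 3) (fun κ => lo P i κ - 2),
      (castSite z : Site (F.P P.K) (k P i)) ∈ pts (k P i) (maxDomT Θ.ν.M₁ (Z P i) (k P i)) ∧
        (castSite z : Site (F.P P.K) (k P i)).shift ⟨0, h0 P⟩ ∈ pts (k P i) (maxDomT Θ.ν.M₁ (Z P i) (k P i)) ∧
        (castSite z : Site (F.P P.K) (k P i)).shift ν' ∈ pts (k P i) (maxDomT Θ.ν.M₁ (Z P i) (k P i)))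
    -- the geometric letter: every fine site whose k-block label lies in the box `[lo − 1, hi + 1]` lies in `Ω₁(Z)` (print: `Λ` deep inside `Z`); dag-n12-c's `far_letter_of_box` turns it into the bond letter `hfar`
    (hZ1 : ∀ P i (y : Site (F.P P.K) 0), B14.Eq22Determines.blockIter (k P i) y ∈ (castSite '' Set.Icc (lo P i - 1) (hi P i + 1) : Set (Site (F.P P.K) (k P i))) → y ∈ maxDomT Θ.ν.M₁ (Z P i) 1)
    (hZblk : ∀ P i, IsBlockUnion (k P i) (Z P i))
    (hdiv : ∀ P i, side (F.P P.K).L Θ.ν.M₁ (k P i) ∣ (F.P P.K).sitesPerDir 0)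
    (hM2 : 2 ≤ Θ.ν.M₁) (hB₃ : 0 ≤ B₃) (ha₁' : 0 < a₁') (hεreg : 0 < Θ.ν.εreg) (ha₀ : Θ.ν.εreg ≤ a₀) (h15 : VariationalThm1RegSepCoP7M F 2 B₃ a₀ a₁') :
    ∃ areg : ∀ P : B12.RunParams, ι P → ℝ, (∀ P i, 0 < areg P i) ∧
      ∀ P : B12.RunParams, lam.kSel P < P.K →
        B15Leaf (WOfRecord₁₃ F 2 (Θ.liveRepin₁₃ F 2)
          { lam with LF := fun P => lfVarOn su2Chart fun i => InstOn.std (Node00.bgMSCoPOfRecord F 2 Θ.ν P.K (k P i) (maxDomT Θ.ν.M₁ (Z P i))) Θ.ν.M₁ (Z P i) (Λ P i) (k P i) (M P i) (areg P i) (anExt (pts (k P i) (Λ P i)) (T P i) (fun177std (Node00.bgMSCoPOfRecord F 2 Θ.ν P.K (k P i) (maxDomT Θ.ν.M₁ (Z P i))) Θ.ν.M₁ (Z P i) (k P i)) (ext P i) (min (1 / 2) (min (R P i / 8) (((12 * ((F.P P.K).d : ℝ)) ^ 2 / (10 * bx P ^ 2)) / (M P i) ^ 5 * (R P i / 2) ^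 2 / (48 * (4 * ((Fintype.card (Plaq (F.P P.K) 0) : ℝ) * (1 + 8 * 𝓐₀ P i ^ 4)) / R P i + 1)))))) } P) := by
  choose areg ha hP using fun P : B12.RunParams =>
    exists_domain_prop1Printed_lfVarOn_std_su2_box_intrinsic_analytic_atZSeqCoPRecord_ofThm1TorusClass_ofMinimiserFamily_ofGaugeLetterLocAtRecordAtTolerance_ofChartLetterN_ofCoercive (F := F) Θ.ν P.K (hd3 P) (h0 P)
      (Z := Z P) (Λ := Λ P) (k := k P) (M := M P) (hk0 := hk0 P) (hk := hk P) (eR₀ := eR₀ P) (heR₀ := heR₀ P) (T := T P) (lo := lo P) (hi := hi P) (n := n P) (hn := hn P)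
      (hN := hN P) (hbox := hbox P) (hZ := hZ P) (hTG0 := hTG0 P) (hN5 := hN5 P) (ext := ext P) (hext := hext P) (hlohi := hlohi P)
      (LO := LO P) (HI := HI P) (hLO := hLO P) (hHI := hHI P) (n' := n' P) (hn' := hn' P) (hn'N := hn'N P) (hR' := hR' P)
      (hbx := hbx P) (hbxM := hbxM P) (hM := hM P) (hR := hR P) (hMin := hMin P)
      (h𝓐₀ := h𝓐₀ P) (N := N P) (hNpos := hNpos P)
      (hNcap := hNcap P) (hGN := hGN P) (hN1 := hN1 P) (e₀ := e₀ P) (cP := cP P) (cθ := cθ P) (cδ := cδ P) (he₀ := he₀ P) (hcP := hcP P) (hcδ := hcδ P) (S := S P)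
      (hP := hP P) (hSΩ := hSΩ P) (a := a P) (θ := θ P) (hθ0 := hθ0 P) (ha0 := ha0 P) (haN := haN P) (hθ := hθ P) (hθk := hθk P) (ha := ha P) (hWj := hWj P)
      (hΩw := hΩw P)
      (hfar := fun i b hb => far_letter_of_box (hbox P i) (hZ1 P i) b hb) (hZblk := hZblk P) (hdiv := hdiv P)
      (hM2 := hM2) (hB₃ := hB₃) (ha₁' := ha₁') (hεreg := hεreg) (ha₀ := ha₀)
      (h15T := thm1TorusClass_of_variationalThm1RegSepCoP7M Θ.ν P.K h15)
  refine ⟨areg, ha, fun P hkP => ?_⟩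
  apply b15Leaf_WOfRecord₁₃_liveRepin₁₃_of_massLive_of_hasResiduals Θ _ hres (P := P)
  · exact hkP
  · exact hpin P hkP
  · exact hmassLive P hkP
  · exact hP P
  · exact h180 P hkP
  · exact h189 P hkP

end Generic

end Summit.QuantumFields.YangMills.BalabanUVNodes.N12AtRecord13Prop1KnitThm1AssembledGaugeLocAtRecordChartLetterNOfRecord

end
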